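import Literature.Algebra.EuclideanLattices.RegevRoutineParams
import Literature.Algebra.EuclideanLattices.RegevPointSetShiftBound
import HarnessLib

/-!
# Regev's per-copy routine as a circuit family, XII: the fibres of the first block (Claims 3.13–3.14)

Twelfth file of the circuit-level construction towards the discharge of
`Literature.Algebra.EuclideanLattices.usvp_of_dihedralCoset` (O. Regev, *Quantum computation and
lattice problems*, SIAM J. Comput. 33 (2004), Thm. 1.1). For a genuine input — the code of a
payload whose rows are those of an integer basis `B` of dimension `n = nOf L` — and the right
guesses, the first block of the routine (file XI: `fW (wordW …) = wOutE (wOut …)`) maps a zone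
pattern `(ix, t, ā)` of a live register to `(f(t, ā) + x̄, u_rest)`, `x̄` the grid point of index
`ix[0, κ)`, `u_rest = ix[κ, kap)` (`wOut_live`); this file decodes the zone patterns and derives
the fibre hypotheses `FibreHyp` of file VII from Regev's Claim 3.13 in the form of
`Regev2004.FiberHyp` (`RegevTwoPoint.lean`: at most one element of each type over a measured
value, partners differ by the hidden shift) and the base-`2M` layout of Lemma 3.2
(`RegevTwoPointDigits.lean`):

* `tOf`, `aOf`/`aZ`, `ixS`/`taS`, `idxOf`, `xbar` — the control bit, the digits `ā ∈ [0, M)ⁿ`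
  (`M = 2^{4n}`), the `ix`/`ta` strings, the index and the grid point of a zone pattern;
  `ctrl_eq_tOf`, **`val_eq_boxEnc`** (the slot value is `g(ā) = ∑ aᵢ (2M)^i`), `digitsOf_taS`,
  `xbar_mem_pointSet`;
* `GoodData` — the data of a genuine input with the right guesses and Regev's fibre hypotheses;
  `Good`, `xIn`; **`wOut_live`**, `wOut_dead`, `fW_zW`;
* `regOf` and **`fibreHyp : FibreHyp (mkParams Q) (semHyp Q) xIn Good r d₀`** with
  `d₀ = dcpShift (2M) n δ`, `δ = hiddenShift i₀ p m u`.

No named fact is introduced.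

## References

* O. Regev, *Quantum computation and lattice problems*, SIAM J. Comput. 33 (2004) 738–760,
  Claims 3.13, 3.14 (p. 15), Lemma 3.2 (p. 6), proof of Lemma 3.12 (p. 14) [Regev2004].
-/

noncomputable section

namespace Literature.Algebra.EuclideanLattices

namespace RegevRoutine

open _root_.Computability Literature.Computability.Complexity Literature.Computability.Complexity.Brick
  Literature.Computability.Complexity.CodeFP Literature.Computability.Cryptography Literature.Computability.Cryptography.DCP
  Literature.Computability.QuantumComplexity Literature.Computability.QuantumComplexity.DCPMixture Regev2004 Finset

/-! ### Bit strings and their values -/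

/-- The value of a string is the `bitVal` of its letters. [folklore] -/
theorem bitsToNat_eq_bitVal (l : List Bool) : bitsToNat l = bitVal (fun t => l.getD t false) l.length := by
  induction l with
  | nil => simp [bitVal]
  | cons b l ih =>
    rw [bitsToNat_cons, ih, List.length_cons]
    -- `bitVal` of a cons: split off digit `0`
    have hsucc : ∀ (f : ℕ → Bool) (k : ℕ), bitVal f (k + 1) = (if f 0 then 1 else 0) + 2 * bitVal (fun t => f (t + 1)) k := by
      intro f k
      induction k with
      | zero => simp [bitVal]
      | succ k ihk =>
        rw [bitVal_succ, ihk, bitVal_succ, pow_succ]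
        split_ifs <;> ring
    rw [hsucc]
    cases b <;> simp

/-- The binary digits of the value of a string are its letters (a private copy: its public home is
`Literature.Computability.Cryptography.testBit_bitsToNat`, `ShorOrdPost.lean`, next to `bitsToNat`,
whose import closure is foreign to this file). [folklore] -/
private theorem testBit_bitsToNat (l : List Bool) (t : ℕ) : (bitsToNat l).testBit t = l.getD t false := by
  rw [bitsToNat_eq_bitVal, testBit_bitVal]
  by_cases ht : t < l.length
  · simp [ht]
  · simp [ht]

/-! ### Decoding a zone pattern -/

section Pattern

variable (Q : PreParams) {L : ℕ} (pat : ZPat (mkParams Q) L (nOf L))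

/-- The control bit `t` of a zone pattern. [cite: Regev2004, Lemma 3.12 (proof, p. 14)] -/
def tOf : Bool := pat.1 ⟨kap (mkParams Q) L, Nat.lt_succ_self _⟩

/-- The digit `aᵢ < M = 2^{4n}` of a zone pattern. [cite: Regev2004, Lemma 3.12 (proof, p. 14: ā ∈ {0,…,M−1}ⁿ)] -/
def aOf (i : Fin (nOf L)) : ℕ := bitsToNat (List.ofFn (pat.2 i))

/-- The digits as an integer vector. [folklore] -/
def aZ : Fin (nOf L) → ℤ := fun i => (aOf Q pat i : ℤ)

/-- The `ix` string of a zone pattern. [folklore] -/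
def ixS : List Bool := ixBits Q L (zoneFn (mkParams Q) L (nOf L) pat)

/-- The `ta` string of a zone pattern. [folklore] -/
def taS : List Bool := taBits L (tacP (mkParams Q) L (nOf L) pat)

/-- `aᵢ < 2^{4n}`. [folklore] -/
theorem aOf_lt (i : Fin (nOf L)) : aOf Q pat i < 2 ^ (4 * nOf L) := by
  have := bitsToNat_lt (List.ofFn (pat.2 i)); simpa [aOf] using this

/-- `ā` lies in the box `[0, M)ⁿ`. [folklore] -/
theorem aZ_mem_box : aZ Q pat ∈ box (nOf L) (2 ^ (4 * nOf L)) := by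
  rw [mem_box_iff]; intro i
  exact ⟨by simp [aZ], by have := aOf_lt Q pat i; simp [aZ]; exact_mod_cast this⟩

/-- The `ix` string, explicitly. [folklore] -/
theorem ixS_eq : ixS Q pat = List.ofFn fun t : Fin (kap (mkParams Q) L) => pat.1 t.castSucc := by
  unfold ixS ixBits
  congr 1; funext t
  rw [zoneFn_lo _ (by have := t.isLt; omega)]
  rfl

/-- Length of the `ix` string. [folklore] -/
@[simp] theorem length_ixS : (ixS Q pat).length = kap (mkParams Q) L := by simp [ixS, ixBits]

/-- Length of the `ta` string. [folklore] -/
@[simp] theorem length_taS : (taS Q pat).length = sig L := by simp [taS, taBits]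

/-- The letters of the `ta` string. [folklore] -/
theorem getD_taS {t : ℕ} (ht : t < sig L) : (taS Q pat).getD t false = tacP (mkParams Q) L (nOf L) pat t := by
  unfold taS taBits
  rw [List.getD_eq_getElem _ _ (by simpa using ht)]
  simp

/-- `tacP` at `0` is the control bit. [folklore] -/
theorem tacP_zero : tacP (mkParams Q) L (nOf L) pat 0 = tOf Q pat := by
  unfold tacP tOf
  rw [Nat.add_zero, zoneFn_lo _ (Nat.lt_succ_self _)]

/-- The control bit read off the `ta` string. [folklore] -/
theorem ctrlBit_taS : ctrlBit (taS Q pat) = tOf Q pat := by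
  have hsig : 0 < sig L := by unfold sig slotW; omega
  have h0 := getD_taS Q pat hsig
  unfold ctrlBit
  cases hl : taS Q pat with
  | nil => have := length_taS Q pat; rw [hl] at this; simp at this; omega
  | cons b l =>
    rw [hl] at h0
    simp only [List.headD_cons, List.getD_cons_zero] at h0 ⊢
    rw [h0, tacP_zero]

/-- The control bit of file VII is `tOf`. [folklore] -/
theorem ctrl_eq_tOf : ctrl (mkParams Q) L (nOf L) pat = tOf Q pat := tacP_zero Q pat

/-- Uniqueness of division with remainder by the field pitch `w = 4n + 1`. [folklore] -/
theorem divMod_unique {w q j q' j' : ℕ} (hj : j < w) (hj' : j' < w) (h : w * q + j = w * q' + j') : q = q' ∧ j = j' := by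
  have hw : 0 < w := by omega
  have h1 : (w * q + j) / w = q := by rw [Nat.add_comm, Nat.add_mul_div_left _ _ hw, Nat.div_eq_of_lt hj, Nat.zero_add]
  have h2 : (w * q' + j') / w = q' := by rw [Nat.add_comm, Nat.add_mul_div_left _ _ hw, Nat.div_eq_of_lt hj', Nat.zero_add]
  have hq : q = q' := by rw [← h1, ← h2, h]
  subst hq
  exact ⟨rfl, by omega⟩

/-- **The `ta` coins after the control bit**: digit field `q`, bit `j` — the pattern's data bit for
`q < n`, `j < 4n`, and `0` otherwise (separators and tail). [folklore] -/
theorem tacP_one_add (q j : ℕ) (hj : j < 4 * nOf L + 1) :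
    tacP (mkParams Q) L (nOf L) pat (1 + ((4 * nOf L + 1) * q + j)) =
      if h : q < nOf L ∧ j < 4 * nOf L then pat.2 ⟨q, h.1⟩ ⟨j, h.2⟩ else false := by
  unfold tacP
  split_ifs with h
  · have e : kap (mkParams Q) L + (1 + ((4 * nOf L + 1) * q + j)) =
        kap (mkParams Q) L + 1 + ((⟨q, h.1⟩ : Fin (nOf L)) : ℕ) * (4 * nOf L + 1) + ((⟨j, h.2⟩ : Fin (4 * nOf L)) : ℕ) := by
      simp only; ring
    rw [e, zoneFn_digit]
  · refine zoneFn_eq_false _ fun hoff => ?_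
    rcases hoff with hlt | ⟨i', hi', b', hb', he⟩
    · omega
    · have he' : (4 * nOf L + 1) * q + j = (4 * nOf L + 1) * i' + b' := by
        have : kap (mkParams Q) L + (1 + ((4 * nOf L + 1) * q + j)) = kap (mkParams Q) L + 1 + (4 * nOf L + 1) * i' + b' := by
          rw [he]; ring
        omega
      obtain ⟨rfl, rfl⟩ := divMod_unique hj (by omega) he'
      exact h ⟨hi', hb'⟩

/-- **The slot value of a zone pattern is `g(ā) = ∑ᵢ aᵢ (2M)^i`** (the base-`2M` number of the
digits, `M = 2^{4n}`). [cite: Regev2004, Lemma 3.2 (the map (a₁,…,aₙ) ↦ a₁ + a₂ 2M + ⋯)] -/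
theorem val_eq_boxEnc : val (mkParams Q) L (nOf L) pat = boxEnc (2 ^ (4 * nOf L + 1)) (aZ Q pat) := by
  set w := 4 * nOf L + 1 with hw
  have hw0 : 0 < w := by omega
  have he : ∀ i : Fin (nOf L), (fun i => (aZ Q pat i).toNat) i < 2 ^ w := fun i => by
    simp only [aZ, Int.toNat_natCast]
    exact (aOf_lt Q pat i).trans (Nat.pow_lt_pow_right (by norm_num) (by omega))
  apply Nat.eq_of_testBit_eq
  intro s
  rw [val, testBit_bitVal, boxEnc]
  obtain ⟨q, j, hj, rfl⟩ : ∃ q j, j < w ∧ s = w * q + j := ⟨s / w, s % w, Nat.mod_lt _ hw0, (Nat.div_add_mod s w).symm⟩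
  by_cases hq : q < nOf L
  · rw [show w * q + j = w * ((⟨q, hq⟩ : Fin (nOf L)) : ℕ) + j from rfl, testBit_digitVal_two_pow he ⟨q, hq⟩ hj]
    simp only [Int.toNat_natCast, aZ, aOf, testBit_bitsToNat]
    have hlt : w * q + j < ell (nOf L) := by
      have h3 : w * (q + 1) ≤ w * nOf L := Nat.mul_le_mul_left _ hq
      have h4 : ell (nOf L) = w * nOf L + 1 := by unfold ell; rw [hw]; ring
      rw [Nat.mul_succ] at h3
      rw [h4]; omega
    rw [decide_eq_true hlt, Bool.true_and, tacP_one_add Q pat q j hj]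
    by_cases hj4 : j < 4 * nOf L
    · rw [dif_pos ⟨hq, hj4⟩, List.getD_eq_getElem _ _ (by simpa using hj4)]; simp
    · rw [dif_neg (fun h => hj4 h.2), List.getD_eq_default _ _ (by simpa using not_lt.1 hj4)]
  · rw [testBit_digitVal_two_pow_of_le he (k := w * q + j) ((Nat.mul_le_mul_left _ (not_lt.1 hq)).trans (Nat.le_add_right _ _))]
    by_cases hlt : w * q + j < ell (nOf L)
    · rw [decide_eq_true hlt, Bool.true_and, tacP_one_add Q pat q j hj, dif_neg (fun h => hq h.1)]
    · rw [decide_eq_false hlt, Bool.false_and]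

/-- A window of the `ta` string inside digit field `i`: its `4n` data bits. [folklore] -/
theorem digit_window (i : Fin (nOf L)) :
    (((taS Q pat).drop 1).drop ((i : ℕ) * (4 * nOf L + 1))).take (4 * nOf L) = List.ofFn (pat.2 i) := by
  have hsw : slotW (nOf L) ≤ sig L := by unfold sig slotW; have := ell_mono (nOf_le L); omega
  apply List.ext_getElem
  · simp only [List.length_take, List.length_drop, length_taS, List.length_ofFn]
    have := digit_lt_slotW (n := nOf L) i.isLt (show 4 * nOf L - 1 < 4 * nOf L by have := i.isLt; omega)
    omega
  · intro b h1 h2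
    rw [List.length_ofFn] at h2
    rw [List.getElem_take, List.getElem_drop, List.getElem_drop, List.getElem_ofFn]
    have hpos : 1 + ((i : ℕ) * (4 * nOf L + 1) + b) < sig L := by have := digit_lt_slotW (n := nOf L) i.isLt h2; omega
    have := getD_taS Q pat hpos
    rw [List.getD_eq_getElem _ _ (by simpa using hpos)] at this
    rw [this, show 1 + ((i : ℕ) * (4 * nOf L + 1) + b) = 1 + ((4 * nOf L + 1) * i + b) by ring, tacP_one_add Q pat i b (by omega),
      dif_pos ⟨i.isLt, h2⟩]

/-- **The digits read off the `ta` string are the pattern's digits.** [folklore] -/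
theorem digitsOf_taS : digitsOf (nOf L) (taS Q pat) = List.ofFn (aOf Q pat) := by
  apply List.ext_getElem (by simp [digitsOf])
  intro i h1 h2
  rw [List.length_ofFn] at h2
  simp only [digitsOf, List.getElem_map, List.getElem_range, List.getElem_ofFn]
  have hw := digit_window Q pat ⟨i, h2⟩
  simp only at hw
  rw [hw]
  rfl

end Pattern

/-- `N = (2M)ⁿ` with `2M = 2^{4n+1}`. [cite: Regev2004, Lemma 3.2 (N = (2M)^n)] -/
theorem modN_eq (L : ℕ) : modN (nOf L) = (2 ^ (4 * nOf L + 1)) ^ nOf L := by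
  rw [modN, ← pow_mul]; congr 1; unfold ell; rw [Nat.add_sub_cancel, Nat.mul_comm]

/-- `M ≤ 2M`. [folklore] -/
theorem M_le_bM (L : ℕ) : 2 ^ (4 * nOf L) ≤ 2 ^ (4 * nOf L + 1) := Nat.pow_le_pow_right (by norm_num) (by omega)

/-- `0 < N`. [folklore] -/
theorem modN_pos (L : ℕ) : 0 < modN (nOf L) := by unfold modN; positivity

/-! ### Genuine inputs with the right guesses -/

section Good

variable (Q : PreParams) (x : List Bool) (B : Matrix (Fin (nOf x.length)) (Fin (nOf x.length)) ℤ)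

/-- The lattice instance of dimension `n = nOf |x|` with basis `B`. [folklore] -/
abbrev instOf : LatticeInstance := ⟨nOf x.length, B⟩

/-- **The data of a genuine input with the right guesses**: a payload whose rows are those of `B`
(padded to length `x.length`), guesses passing the liveness tests, the register count below `rmax` with
its slots inside the solver's block, and Regev's fibre hypotheses (Claim 3.13) for the modulus,
the residue, the coefficient vector `u` of the shortest vector and the point set of the radius
guess. [cite: Regev2004, Claim 3.13 (hypotheses) and Thm. 1.1 (proof, p. 7: the right values of l, m, i₀)] -/
structure GoodData where
  /-- the payload -/
  pl : Payload
  /-- the padding -/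
  pad : List Bool
  /-- the input is the padded code of the payload -/
  hx : x = boolPair (ePayload.encode pl) pad
  /-- its rows are those of `B` -/
  hrows : pl.rows = rowsOf (instOf x B)
  /-- the right guesses -/
  G0 : Guess
  /-- the index coins fit into the `ix` field -/
  hκ : numIdx x.length pl G0 ≤ kap (mkParams Q) x.length
  /-- `i₀ < n` -/
  hi0 : G0.i0 < nOf x.length
  /-- `0 < m` -/
  hm0 : 0 < G0.m
  /-- `m < p` -/
  hmp : G0.m < pl.modP
  /-- the radius guess is in the table -/
  hrho : G0.rho < pl.radii.length
  /-- `1 ≤ n` -/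
  hn1 : 1 ≤ nOf x.length
  /-- `r ≤ rmax` -/
  hr : G0.r' ≤ rmax (mkParams Q) x.length
  /-- the live slots fit into the solver's block -/
  fits : ell (nOf x.length) + G0.r' * slotW (nOf x.length) ≤ ell (nOf x.length) + Q.FD.ancillas (ell (nOf x.length))
  /-- the coefficient vector of the shortest vector -/
  u : Fin (nOf x.length) → ℤ
  /-- Regev's fibre hypotheses -/
  HF : Regev2004.FiberHyp (instOf x B) ⟨G0.i0, hi0⟩ (pl.modP : ℤ) (G0.m : ℤ) u
    (pointSet (nOf x.length) (qLevels x.length pl) (radius pl G0) (radius_pos pl G0))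

variable {Q x B} (D : GoodData Q x B)

namespace GoodData

/-- The payload of the input. [folklore] -/
@[simp] theorem payloadOf_xIn : payloadOf x = D.pl := (congrArg payloadOf D.hx).trans (payloadOf_input _ _)

/-- The coordinate `i₀`. [folklore] -/
abbrev i0 : Fin (nOf x.length) := ⟨D.G0.i0, D.hi0⟩
/-- The number of index coins `κ`. [folklore] -/
def κ : ℕ := numIdx x.length D.pl D.G0
/-- The cell size `Δ`. [folklore] -/
def Δ : ℕ := radius D.pl D.G0
/-- `0 < Δ`. [folklore] -/
theorem Δ_pos : 0 < D.Δ := radius_pos _ _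
/-- The point set `X`. [cite: Regev2004, Lemma 3.12 (proof, p. 14: the grid points of the ball)] -/
def X : Finset (Fin (nOf x.length) → ℤ) := pointSet (nOf x.length) (qLevels x.length D.pl) D.Δ D.Δ_pos
/-- The hidden shift `δ`. [cite: Regev2004, Claim 3.13] -/
def δ : Fin (nOf x.length) → ℤ := hiddenShift D.i0 (D.pl.modP : ℤ) (D.G0.m : ℤ) D.u
/-- The shortest vector `ū = u ᵥ* B`. [folklore] -/
def uv : Fin (nOf x.length) → ℤ := Matrix.vecMul D.u B
/-- The DCP shift `d₀`. [cite: Regev2004, Lemma 3.2] -/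
def d0 : ℕ := dcpShift (2 ^ (4 * nOf x.length + 1)) (nOf x.length) D.δ

/-- **Good guess patterns**: those read as the right guesses. [cite: Regev2004, Thm. 1.1 (proof, p. 7)] -/
def Good (gp : GPat (mkParams Q) x.length) : Prop := readGuess Q.sizes x.length D.pl (List.ofFn gp) = D.G0

/-- `Good` is decidable. [folklore] -/
instance instDecidablePredGood : DecidablePred D.Good := fun _ => by unfold Good; infer_instance

/-- Liveness on the right guesses is `k < r`. [folklore] -/
theorem live_iff (k : ℕ) : Live Q.sizes x.length D.pl D.G0 k ↔ k < D.G0.r' :=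
  ⟨fun h => h.1, fun h => ⟨h, D.hκ, D.hi0, D.hm0, D.hmp, D.hrho, D.hn1⟩⟩

end GoodData

/-- The guess zone of an extended guess pattern is the pattern. [folklore] -/
theorem gBits_gExt (gp : GPat (mkParams Q) x.length) : gBits Q x.length (gExt (mkParams Q) x.length gp) = List.ofFn gp := by
  unfold gBits; congr 1; funext t; rw [gExt, dif_pos t.isLt]

/-- **Liveness of file XI on a genuine input with a good guess pattern is `k < r`.** [folklore] -/
theorem act_iff_good {gp : GPat (mkParams Q) x.length} (hg : D.Good gp) (k : ℕ) : Act Q x.length x (gExt (mkParams Q) x.length gp) k ↔ k < D.G0.r' := by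
  unfold Act
  rw [D.payloadOf_xIn, gBits_gExt, hg]
  exact D.live_iff k

/-! ### The first block on a zone pattern -/

section Value

variable (pat : ZPat (mkParams Q) x.length (nOf x.length))

/-- The index of the grid point. [folklore] -/
def idxOf : ℕ := bitsToNat ((ixS Q pat).take D.κ)
/-- The junk coins `u_rest`. [folklore] -/
def urest : List Bool := (ixS Q pat).drop D.κ
/-- **The grid point `x̄`.** [cite: Regev2004, Lemma 3.12 (proof, p. 14)] -/
def xbar : Fin (nOf x.length) → ℤ := unrank D.Δ (nOf x.length) (qLevels x.length D.pl) (idxOf D pat)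
/-- The control bit as an integer. [folklore] -/
def tZ : ℤ := if tOf Q pat then 1 else 0
/-- **The measured value `y = f(t, ā) + x̄`.** [cite: Regev2004, Lemma 3.12 (proof, p. 14)] -/
def yOf : Fin (nOf x.length) → ℤ := twoPointVec (instOf x B) D.i0 (D.pl.modP : ℤ) (D.G0.m : ℤ) (tZ pat) (aZ Q pat) + xbar D pat

/-- `idx < 2^κ`. [folklore] -/
theorem idxOf_lt : idxOf D pat < 2 ^ D.κ := by
  have h := bitsToNat_lt ((ixS Q pat).take D.κ)
  rw [List.length_take, length_ixS, min_eq_left (show D.κ ≤ kap (mkParams Q) x.length from D.hκ)] at h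
  exact h

/-- `idx` is below the size of the quantised ball. [folklore] -/
theorem idxOf_lt_card : idxOf D pat < (qBall (nOf x.length) (qLevels x.length D.pl) D.Δ).card :=
  (idxOf_lt D pat).trans_le (by rw [GoodData.κ, numIdx_eq_kappa]; exact two_pow_kappa_le _ _ _ D.Δ_pos)

/-- **The grid point lies in the point set.** [folklore] -/
theorem xbar_mem : xbar D pat ∈ D.X := by
  rw [GoodData.X, pointSet_eq_image_unrank]
  refine mem_image.2 ⟨idxOf D pat, mem_range.2 ?_, rfl⟩
  change idxOf D pat < 2 ^ Regev2004.kappa (nOf x.length) (qLevels x.length D.pl) (radius D.pl D.G0)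
  rw [← numIdx_eq_kappa]; exact idxOf_lt D pat

/-- The coefficient list of file IX is Regev's coefficient vector. [cite: Regev2004, Lemma 3.4 (proof, p. 8)] -/
theorem coeffOf_coeffsOf :
    coeffOf (nOf x.length) (coeffsOf D.pl.modP D.G0.m D.G0.i0 (tOf Q pat) (List.ofFn (aOf Q pat))) =
      twoPointCoeffs D.i0 (D.pl.modP : ℤ) (D.G0.m : ℤ) (tZ pat) (aZ Q pat) := by
  funext i
  unfold coeffOf coeffsOf twoPointCoeffs
  rw [List.getD_eq_getElem _ _ (by simp), List.getElem_set]
  by_cases hi : D.G0.i0 = i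
  · rw [if_pos hi, show D.i0 = i from Fin.ext hi, Function.update_self, hi, Regev2004.getD_ofFn _ _ i]
    simp only [tZ, aZ]
    split_ifs <;> ring
  · rw [if_neg hi, Function.update_of_ne (fun h => hi (congrArg Fin.val h).symm)]
    simp [aZ]

/-- `zipWith (+)` of two `ofFn`s. [folklore] -/
theorem zipWith_add_ofFn {n : ℕ} (f g : Fin n → ℤ) : List.zipWith (· + ·) (List.ofFn f) (List.ofFn g) = List.ofFn (f + g) := by
  apply List.ext_getElem (by simp)
  intro i h1 h2
  simp

/-- **The first block on a zone pattern of a live register**: `(y, u_rest, ε, ε)`. [cite: Regev2004, Lemma 3.12 (proof, p. 14)] -/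
theorem wOut_live {gs : List Bool} (hg : readGuess Q.sizes x.length D.pl gs = D.G0) {k : ℕ} (hk : k < D.G0.r') :
    wOut Q.sizes x.length x gs (ixS Q pat) (taS Q pat) k = (List.ofFn (yOf D pat), (urest D pat, ([], []))) := by
  unfold wOut
  rw [D.payloadOf_xIn, hg, if_pos ((D.live_iff k).2 hk)]
  refine Prod.ext ?_ rfl
  change valueOf x.length D.pl D.G0 (ixS Q pat) (taS Q pat) = List.ofFn (yOf D pat)
  unfold valueOf latticeOf
  rw [D.hrows, ctrlBit_taS, digitsOf_taS, vecMulL_rowsOf (instOf x B), coeffOf_coeffsOf, pointOf, zipWith_add_ofFn]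
  rfl

/-- **The first block on a zone pattern of a dead register**: `(ε, ε, ix, ta)`. [folklore] -/
theorem wOut_dead {gs : List Bool} (hg : readGuess Q.sizes x.length D.pl gs = D.G0) {k : ℕ} (hk : ¬ k < D.G0.r') :
    wOut Q.sizes x.length x gs (ixS Q pat) (taS Q pat) k = ([], ([], (ixS Q pat, taS Q pat))) := by
  unfold wOut
  rw [D.payloadOf_xIn, hg, if_neg (fun h => hk ((D.live_iff k).1 h))]

/-- **The first block on the word of a zone pattern.** [cite: Regev2004, Lemma 3.12 (proof, p. 14)] -/
theorem fW_zW (gp : GPat (mkParams Q) x.length) {k : ℕ} (hk : k ≤ rmax (mkParams Q) x.length) :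
    (mkParams Q).fW (zW (mkParams Q) x.length (nOf x.length) x gp k pat) =
      wOutE (wOut Q.sizes x.length x (List.ofFn gp) (ixS Q pat) (taS Q pat) k) := by
  rw [zW, fW_wordW Q _ _ _ rfl hk, gBits_gExt]
  rfl

end Value

/-! ### Helpers: low bits, the `ix` string, building a pattern -/

section Helpers

variable (pat : ZPat (mkParams Q) x.length (nOf x.length))

/-- `lowBits K r` has length `K`. [folklore] -/
@[simp] theorem length_lowBits (K r : ℕ) : (lowBits K r).length = K := by simp [lowBits]

/-- The value of `lowBits K r` is `r` for `r < 2^K`. [folklore] -/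
theorem bitsToNat_lowBits {K r : ℕ} (h : r < 2 ^ K) : bitsToNat (lowBits K r) = r := by
  have hlen : (encodeNat r).length ≤ K := by rw [TM2Pass.length_encodeNat_eq_size]; exact Nat.size_le.2 h
  rw [lowBits, List.take_append, List.take_of_length_le hlen, List.take_replicate, bitsToNat_append, bitsToNat_encodeNat,
    bitsToNat_replicate_false, mul_zero, add_zero]

/-- The first `κ` letters of the `ix` string are the low bits of the index. [folklore] -/
theorem take_ixS : (ixS Q pat).take D.κ = lowBits D.κ (idxOf D pat) := by
  have h := lowBits_bitsToNat ((ixS Q pat).take D.κ)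
  rw [List.length_take, length_ixS, min_eq_left (show D.κ ≤ kap (mkParams Q) x.length from D.hκ)] at h
  exact h.symm

/-- **The `ix` string is the low bits of the index followed by the junk coins.** [folklore] -/
theorem ixS_eq_append : ixS Q pat = lowBits D.κ (idxOf D pat) ++ urest D pat := by
  rw [← take_ixS D pat, urest, List.take_append_drop]

/-- **Building a zone pattern** from an `ix` string, a control bit and digits in the box. [folklore] -/
def mkPat (ixs : List Bool) (t : Bool) (a : Fin (nOf x.length) → ℤ) : ZPat (mkParams Q) x.length (nOf x.length) :=
  (fun j => if (j : ℕ) < kap (mkParams Q) x.length then ixs.getD j false else t, fun i b => (natBits (4 * nOf x.length) (a i).toNat).getD b false)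

/-- The control bit of a built pattern. [folklore] -/
@[simp] theorem tOf_mkPat (ixs : List Bool) (t : Bool) (a : Fin (nOf x.length) → ℤ) : tOf Q (mkPat (Q := Q) ixs t a) = t := by
  simp [tOf, mkPat]

/-- The `ix` string of a built pattern. [folklore] -/
theorem ixS_mkPat {ixs : List Bool} (hlen : ixs.length = kap (mkParams Q) x.length) (t : Bool) (a : Fin (nOf x.length) → ℤ) :
    ixS Q (mkPat (Q := Q) ixs t a) = ixs := by
  rw [ixS_eq]
  apply List.ext_getElem (by simp [hlen])
  intro j h1 h2
  simp only [List.getElem_ofFn, mkPat, Fin.val_castSucc]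
  rw [if_pos (by simpa using h1), List.getD_eq_getElem _ _ h2]

/-- The digits of a built pattern. [folklore] -/
theorem aZ_mkPat (ixs : List Bool) (t : Bool) {a : Fin (nOf x.length) → ℤ} (ha : a ∈ box (nOf x.length) (2 ^ (4 * nOf x.length))) :
    aZ Q (mkPat (Q := Q) ixs t a) = a := by
  rw [mem_box_iff] at ha
  funext i
  obtain ⟨h0, hlt⟩ := ha i
  have hlt' : (a i).toNat < 2 ^ (4 * nOf x.length) := by
    have : ((a i).toNat : ℤ) < 2 ^ (4 * nOf x.length) := by rw [Int.toNat_of_nonneg h0]; exact_mod_cast hlt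
    exact_mod_cast this
  simp only [aZ, aOf, mkPat]
  have e : (List.ofFn fun b : Fin (4 * nOf x.length) => (natBits (4 * nOf x.length) (a i).toNat).getD b false) = natBits (4 * nOf x.length) (a i).toNat := by
    apply List.ext_getElem (by simp)
    intro b h1 h2
    rw [List.getElem_ofFn, List.getD_eq_getElem _ _ h2]
  rw [e, bitsToNat_natBits hlt', Int.toNat_of_nonneg h0]

/-- **A zone pattern is determined by its control bit, its `ix` string and its digits.** [folklore] -/
theorem pat_ext {pat pat' : ZPat (mkParams Q) x.length (nOf x.length)} (ht : tOf Q pat' = tOf Q pat) (hix : ixS Q pat' = ixS Q pat)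
    (ha : aOf Q pat' = aOf Q pat) : pat' = pat := by
  refine Prod.ext (funext fun j => ?_) (funext fun i => funext fun b => ?_)
  · by_cases hj : (j : ℕ) < kap (mkParams Q) x.length
    · have := congrArg (fun l => l.getD j false) hix
      simp only [ixS_eq] at this
      rw [List.getD_eq_getElem _ _ (by simpa using hj), List.getD_eq_getElem _ _ (by simpa using hj)] at this
      simpa [Fin.castSucc, Fin.castAdd, Fin.castLE] using this
    · have hje : j = ⟨kap (mkParams Q) x.length, Nat.lt_succ_self _⟩ := Fin.ext (by have := j.isLt; simp; omega)
      rw [hje]; exact ht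
  · have hi := congrFun ha i
    simp only [aOf] at hi
    have hl := Literature.Computability.FineGrained.BruteForce.bitsToNat_injective_of_length_eq (by simp) hi
    have := congrArg (fun l => l.getD b false) hl
    simpa [Regev2004.getD_ofFn] using this

/-- For a live register, two zone patterns have the same first-block output iff they have the same
measured value and the same junk coins. [folklore] -/
theorem fW_eq_iff_live {gp : GPat (mkParams Q) x.length} (hg : D.Good gp) {k : ℕ} (hk : k < D.G0.r') (pat pat' : ZPat (mkParams Q) x.length (nOf x.length)) :
    (mkParams Q).fW (zW (mkParams Q) x.length (nOf x.length) x gp k pat') = (mkParams Q).fW (zW (mkParams Q) x.length (nOf x.length) x gp k pat) ↔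
      yOf D pat' = yOf D pat ∧ urest D pat' = urest D pat := by
  have hkr : k ≤ rmax (mkParams Q) x.length := (hk.le.trans D.hr)
  rw [fW_zW pat gp hkr, fW_zW pat' gp hkr, wOutE_injective.eq_iff, wOut_live D pat hg hk, wOut_live D pat' hg hk]
  constructor
  · intro h
    have h1 := congrArg Prod.fst h
    have h2 := congrArg (fun o => o.2.1) h
    exact ⟨List.ofFn_injective h1, h2⟩
  · rintro ⟨h1, h2⟩; rw [h1, h2]

end Helpers

/-! ### The register contents of a zone pattern -/

section RegOf

/-- The register value of a digit vector: `g(ā) mod N` (`= g(ā)` on the box). [cite: Regev2004, Lemma 3.2] -/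
def encA (a : Fin (nOf x.length) → ℤ) : ℕ := boxEnc (2 ^ (4 * nOf x.length + 1)) a % modN (nOf x.length)

/-- `encA a < N`. [folklore] -/
theorem encA_lt (a : Fin (nOf x.length) → ℤ) : encA a < modN (nOf x.length) := Nat.mod_lt _ (modN_pos x.length)

/-- On the box, `encA` is `g(ā)`. [folklore] -/
theorem encA_eq {a : Fin (nOf x.length) → ℤ} (ha : a ∈ box (nOf x.length) (2 ^ (4 * nOf x.length))) : encA a = boxEnc (2 ^ (4 * nOf x.length + 1)) a := by
  rw [encA, Nat.mod_eq_of_lt]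
  rw [modN_eq]; exact boxEnc_lt (M_le_bM x.length) ha

/-- **The register value of a partner**: `g(ā + δ) = (g(ā) + d₀) mod N`. [cite: Regev2004, Lemma 3.2 (proof: the difference is the fixed d)] -/
theorem encA_add_delta {a : Fin (nOf x.length) → ℤ} (ha : a ∈ box (nOf x.length) (2 ^ (4 * nOf x.length))) (haδ : a + D.δ ∈ box (nOf x.length) (2 ^ (4 * nOf x.length))) :
    encA (a + D.δ) = (encA a + D.d0) % modN (nOf x.length) := by
  rw [encA_eq haδ, encA_eq ha, GoodData.d0, modN_eq]
  exact boxEnc_add_eq_mod (M_le_bM x.length) ha haδ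

/-- The partner test of a register content `(t, ā, x̄)`. [cite: Regev2004, Claim 3.14 (ā' ∈ A and x̄' in the shifted ball)] -/
def HasPartner (t : Bool) (a pt : Fin (nOf x.length) → ℤ) : Prop :=
  if t then a - D.δ ∈ box (nOf x.length) (2 ^ (4 * nOf x.length)) ∧ pt + D.uv ∈ D.X else a + D.δ ∈ box (nOf x.length) (2 ^ (4 * nOf x.length)) ∧ pt - D.uv ∈ D.X

/-- The partner test is decidable. [folklore] -/
instance instDecidableHasPartner (t : Bool) (a pt : Fin (nOf x.length) → ℤ) : Decidable (HasPartner D t a pt) := by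
  unfold HasPartner; infer_instance

/-- The type-`0` digits of the pair through `(t, ā)`. [folklore] -/
def baseA (t : Bool) (a : Fin (nOf x.length) → ℤ) : Fin (nOf x.length) → ℤ := if t then a - D.δ else a

/-- **The register content determined by `(t, ā, x̄)`**: a good register on the type-`0` digits if
the partner exists, a bad one otherwise. [cite: Regev2004, Lemma 3.12 (proof, p. 14: "the state collapses to … otherwise a bad register")] -/
def regOf' (t : Bool) (a pt : Fin (nOf x.length) → ℤ) : Register (modN (nOf x.length)) :=
  if HasPartner D t a pt then (none, ⟨encA (baseA D t a), encA_lt _⟩) else (some t, ⟨encA a, encA_lt _⟩)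

/-- The register content of a zone pattern. [folklore] -/
def regOf (pat : ZPat (mkParams Q) x.length (nOf x.length)) : Register (modN (nOf x.length)) := regOf' D (tOf Q pat) (aZ Q pat) (xbar D pat)

/-- `RegRel` for a good register, type `0`. [folklore] -/
theorem regRel_none_false {N d x₀ : ℕ} (h : x₀ < N) {y : ℕ} (hy : y = x₀) : RegRel N d (none, ⟨x₀, h⟩) false y :=
  Or.inr ⟨rfl, Or.inl ⟨rfl, hy⟩⟩

/-- `RegRel` for a good register, type `1`. [folklore] -/
theorem regRel_none_true {N d x₀ : ℕ} (h : x₀ < N) {y : ℕ} (hy : y = (x₀ + d) % N) : RegRel N d (none, ⟨x₀, h⟩) true y :=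
  Or.inr ⟨rfl, Or.inr ⟨rfl, hy⟩⟩

/-- `RegRel` for a bad register. [folklore] -/
theorem regRel_some {N d x₀ : ℕ} (h : x₀ < N) (b : Bool) {y : ℕ} (hy : y = x₀) : RegRel N d (some b, ⟨x₀, h⟩) b y :=
  Or.inl ⟨rfl, hy⟩

end RegOf

/-! ### Claim 3.13 on zone patterns -/

section Claim

variable (pat pat' : ZPat (mkParams Q) x.length (nOf x.length))

/-- `tZ ∈ {0, 1}`. [folklore] -/
theorem tZ_cases (p : ZPat (mkParams Q) x.length (nOf x.length)) : tZ p = 0 ∨ tZ p = 1 := by unfold tZ; split_ifs <;> simp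

/-- `tZ` of control bit `false`/`true`. [folklore] -/
theorem tZ_eq (p : ZPat (mkParams Q) x.length (nOf x.length)) : tZ p = if tOf Q p then 1 else 0 := rfl

/-- **Same type, same value: same content** (Claim 3.13, first part). [cite: Regev2004, Claim 3.13 (first part)] -/
theorem eq_of_yOf_eq_same (hy : yOf D pat' = yOf D pat) (ht : tOf Q pat' = tOf Q pat) : aZ Q pat' = aZ Q pat ∧ xbar D pat' = xbar D pat := by
  have htz : tZ pat' = tZ pat := by rw [tZ_eq, tZ_eq, ht]
  have hmem : twoPointVec (instOf x B) D.i0 (D.pl.modP : ℤ) (D.G0.m : ℤ) (tZ pat) (aZ Q pat) + xbar D pat -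
      twoPointVec (instOf x B) D.i0 (D.pl.modP : ℤ) (D.G0.m : ℤ) (tZ pat) (aZ Q pat') ∈ D.X := by
    have e : twoPointVec (instOf x B) D.i0 (D.pl.modP : ℤ) (D.G0.m : ℤ) (tZ pat) (aZ Q pat) + xbar D pat -
        twoPointVec (instOf x B) D.i0 (D.pl.modP : ℤ) (D.G0.m : ℤ) (tZ pat) (aZ Q pat') = xbar D pat' := by
      have h := hy; unfold yOf at h; rw [htz] at h; rw [← h]; abel
    rw [e]; exact xbar_mem D pat'
  have ha := (D.HF.mem_fiber_same_iff (tZ_cases pat) (xbar_mem D pat) (aZ Q pat')).1 hmem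
  refine ⟨ha, ?_⟩
  have := hy
  rw [yOf, yOf, htz, ha] at this
  exact add_left_cancel this

/-- `f(1, ā + δ) = f(0, ā) + ū`, with the data's names. [cite: Regev2004, Claim 3.14 (proof, p. 15)] -/
theorem twoPoint_add_delta (a : Fin (nOf x.length) → ℤ) :
    twoPointVec (instOf x B) D.i0 (D.pl.modP : ℤ) (D.G0.m : ℤ) 1 (a + D.δ) =
      twoPointVec (instOf x B) D.i0 (D.pl.modP : ℤ) (D.G0.m : ℤ) 0 a + D.uv :=
  twoPointVec_partner _ _ D.HF.dvd a

/-- `f(0, ā − δ) = f(1, ā) − ū`, with the data's names. [cite: Regev2004, Claim 3.14 (proof, p. 15)] -/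
theorem twoPoint_sub_delta (a : Fin (nOf x.length) → ℤ) :
    twoPointVec (instOf x B) D.i0 (D.pl.modP : ℤ) (D.G0.m : ℤ) 0 (a - D.δ) =
      twoPointVec (instOf x B) D.i0 (D.pl.modP : ℤ) (D.G0.m : ℤ) 1 a - D.uv :=
  twoPointVec_partner' _ _ D.HF.dvd a

/-- **Type `0` then type `1` over the same value: the digits differ by the hidden shift and the
points by the shortest vector** (Claim 3.13, second part). [cite: Regev2004, Claim 3.13 (second part) and Claim 3.14] -/
theorem eq_of_yOf_eq_ft (hy : yOf D pat' = yOf D pat) (ht : tOf Q pat = false) (ht' : tOf Q pat' = true) :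
    aZ Q pat' = aZ Q pat + D.δ ∧ xbar D pat - D.uv ∈ D.X ∧ xbar D pat' = xbar D pat - D.uv := by
  have h0 : tZ pat = 0 := by rw [tZ_eq, ht]; rfl
  have h1 : tZ pat' = 1 := by rw [tZ_eq, ht']; rfl
  have e : twoPointVec (instOf x B) D.i0 (D.pl.modP : ℤ) (D.G0.m : ℤ) 0 (aZ Q pat) + xbar D pat -
      twoPointVec (instOf x B) D.i0 (D.pl.modP : ℤ) (D.G0.m : ℤ) 1 (aZ Q pat') = xbar D pat' := by
    have h := hy; unfold yOf at h; rw [h0, h1] at h; rw [← h]; abel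
  have hmem : twoPointVec (instOf x B) D.i0 (D.pl.modP : ℤ) (D.G0.m : ℤ) 0 (aZ Q pat) + xbar D pat -
      twoPointVec (instOf x B) D.i0 (D.pl.modP : ℤ) (D.G0.m : ℤ) 1 (aZ Q pat') ∈ D.X := by rw [e]; exact xbar_mem D pat'
  obtain ⟨ha, hx⟩ := (D.HF.mem_fiber_one_iff (xbar_mem D pat) (aZ Q pat')).1 hmem
  refine ⟨ha, hx, ?_⟩
  rw [← e, ha, twoPointVec_partner _ _ D.HF.dvd]
  unfold GoodData.uv; abel

/-- **Type `1` then type `0` over the same value.** [cite: Regev2004, Claim 3.13 (second part) and Claim 3.14] -/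
theorem eq_of_yOf_eq_tf (hy : yOf D pat' = yOf D pat) (ht : tOf Q pat = true) (ht' : tOf Q pat' = false) :
    aZ Q pat' = aZ Q pat - D.δ ∧ xbar D pat + D.uv ∈ D.X ∧ xbar D pat' = xbar D pat + D.uv := by
  have h1 : tZ pat = 1 := by rw [tZ_eq, ht]; rfl
  have h0 : tZ pat' = 0 := by rw [tZ_eq, ht']; rfl
  have e : twoPointVec (instOf x B) D.i0 (D.pl.modP : ℤ) (D.G0.m : ℤ) 1 (aZ Q pat) + xbar D pat -
      twoPointVec (instOf x B) D.i0 (D.pl.modP : ℤ) (D.G0.m : ℤ) 0 (aZ Q pat') = xbar D pat' := by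
    have h := hy; unfold yOf at h; rw [h0, h1] at h; rw [← h]; abel
  have hmem : twoPointVec (instOf x B) D.i0 (D.pl.modP : ℤ) (D.G0.m : ℤ) 1 (aZ Q pat) + xbar D pat -
      twoPointVec (instOf x B) D.i0 (D.pl.modP : ℤ) (D.G0.m : ℤ) 0 (aZ Q pat') ∈ D.X := by rw [e]; exact xbar_mem D pat'
  obtain ⟨ha, hx⟩ := (D.HF.mem_fiber_zero_iff (xbar_mem D pat) (aZ Q pat')).1 hmem
  refine ⟨ha, hx, ?_⟩
  rw [← e, ha, twoPointVec_partner' _ _ D.HF.dvd]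
  unfold GoodData.uv; abel

end Claim

/-! ### The fibre hypotheses -/

section Fibre

variable (pat pat' : ZPat (mkParams Q) x.length (nOf x.length))

/-- The index is the rank of the grid point. [folklore] -/
theorem rank_xbar : rank D.Δ (nOf x.length) (qLevels x.length D.pl) (xbar D pat) = idxOf D pat :=
  rank_unrank D.Δ_pos (idxOf_lt_card D pat)

/-- Same value, same junk coins and same type: same pattern. [folklore] -/
theorem pat_eq_of_same (hy : yOf D pat' = yOf D pat) (hu : urest D pat' = urest D pat) (ht : tOf Q pat' = tOf Q pat) : pat' = pat := by
  obtain ⟨ha, hx⟩ := eq_of_yOf_eq_same D pat pat' hy ht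
  have hidx : idxOf D pat' = idxOf D pat := by rw [← rank_xbar D pat, ← rank_xbar D pat', hx]
  refine pat_ext (Q := Q) ht ?_ ?_
  · rw [ixS_eq_append D pat, ixS_eq_append D pat', hidx, hu]
  · funext i; have := congrFun ha i; simp only [aZ, Nat.cast_inj] at this; exact this

/-- **`rel`**: over a live register, the fibre of the first block through `pat` lies in the register
relation of `regOf pat`, on which `regOf` is constant. [cite: Regev2004, Claim 3.13 and Lemma 3.2] -/
theorem rel_of_yOf_eq (hy : yOf D pat' = yOf D pat) (hu : urest D pat' = urest D pat) :
    RegRel (modN (nOf x.length)) D.d0 (regOf D pat) (ctrl (mkParams Q) x.length (nOf x.length) pat') (val (mkParams Q) x.length (nOf x.length) pat') ∧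
      regOf D pat' = regOf D pat := by
  rw [ctrl_eq_tOf, val_eq_boxEnc, ← encA_eq (aZ_mem_box Q pat')]
  have hbox := aZ_mem_box Q pat
  have hbox' := aZ_mem_box Q pat'
  by_cases ht : tOf Q pat' = tOf Q pat
  · -- same type: same pattern
    have hpp := pat_eq_of_same D pat pat' hy hu ht
    subst hpp
    refine ⟨?_, rfl⟩
    unfold regOf regOf'
    split_ifs with hP
    · cases htt : tOf Q pat'
      · exact regRel_none_false _ (by simp [baseA])
      · refine regRel_none_true _ ?_
        rw [htt, HasPartner, if_pos rfl] at hP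
        simp only [baseA, if_true]
        have := encA_add_delta D hP.1 (by rw [sub_add_cancel]; exact hbox')
        rw [sub_add_cancel] at this
        exact this
    · exact regRel_some _ _ rfl
  · cases ht0 : tOf Q pat
    · -- `pat` of type 0, `pat'` of type 1
      have ht1 : tOf Q pat' = true := by cases h : tOf Q pat' <;> simp_all
      obtain ⟨ha, hx, hx'⟩ := eq_of_yOf_eq_ft D pat pat' hy ht0 ht1
      have hP : HasPartner D false (aZ Q pat) (xbar D pat) := by
        rw [HasPartner, if_neg Bool.false_ne_true]; exact ⟨ha ▸ hbox', hx⟩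
      have hP' : HasPartner D true (aZ Q pat') (xbar D pat') := by
        rw [HasPartner, if_pos rfl, ha, hx', add_sub_cancel_right, sub_add_cancel]; exact ⟨hbox, xbar_mem D pat⟩
      have e1 : regOf D pat = (none, ⟨encA (aZ Q pat), encA_lt _⟩) := by
        rw [regOf, ht0, regOf', if_pos hP]; simp [baseA]
      have e2 : regOf D pat' = (none, ⟨encA (aZ Q pat), encA_lt _⟩) := by
        rw [regOf, ht1, regOf', if_pos hP']; simp [baseA, ha]
      rw [e1, e2, ht1]
      exact ⟨regRel_none_true _ (by rw [ha]; exact encA_add_delta D hbox (ha ▸ hbox')), rfl⟩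
    · -- `pat` of type 1, `pat'` of type 0
      have ht1 : tOf Q pat' = false := by cases h : tOf Q pat' <;> simp_all
      obtain ⟨ha, hx, hx'⟩ := eq_of_yOf_eq_tf D pat pat' hy ht0 ht1
      have hP : HasPartner D true (aZ Q pat) (xbar D pat) := by
        rw [HasPartner, if_pos rfl]; exact ⟨ha ▸ hbox', hx⟩
      have hP' : HasPartner D false (aZ Q pat') (xbar D pat') := by
        rw [HasPartner, if_neg Bool.false_ne_true, ha, hx', sub_add_cancel, add_sub_cancel_right]; exact ⟨hbox, xbar_mem D pat⟩
      have e1 : regOf D pat = (none, ⟨encA (aZ Q pat - D.δ), encA_lt _⟩) := by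
        rw [regOf, ht0, regOf', if_pos hP]; simp [baseA]
      have e2 : regOf D pat' = (none, ⟨encA (aZ Q pat - D.δ), encA_lt _⟩) := by
        rw [regOf, ht1, regOf', if_pos hP']; simp [baseA, ha]
      rw [e1, e2, ht1]
      exact ⟨regRel_none_false _ (by rw [ha]), rfl⟩

/-- **`inj`**: within a fibre, the control bit (hence the type) determines the pattern. [cite: Regev2004, Claim 3.13 (first part)] -/
theorem inj_of_yOf_eq (hy : yOf D pat' = yOf D pat) (hu : urest D pat' = urest D pat)
    (hc : ctrl (mkParams Q) x.length (nOf x.length) pat' = ctrl (mkParams Q) x.length (nOf x.length) pat) : pat' = pat :=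
  pat_eq_of_same D pat pat' hy hu (by rwa [ctrl_eq_tOf, ctrl_eq_tOf] at hc)

/-- The pattern of the partner content `(t', ā', x̄')` with the same junk coins. [folklore] -/
def partnerPat (t' : Bool) (a' x' : Fin (nOf x.length) → ℤ) : ZPat (mkParams Q) x.length (nOf x.length) :=
  mkPat (Q := Q) (lowBits D.κ (rank D.Δ (nOf x.length) (qLevels x.length D.pl) x') ++ urest D pat) t' a'

/-- The grid point of the partner pattern is the given point of `X`. [folklore] -/
theorem xbar_partnerPat (t' : Bool) (a' : Fin (nOf x.length) → ℤ) {x' : Fin (nOf x.length) → ℤ} (hx' : x' ∈ D.X) :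
    xbar D (partnerPat D pat t' a' x') = x' := by
  have hlen : (lowBits D.κ (rank D.Δ (nOf x.length) (qLevels x.length D.pl) x') ++ urest D pat).length = kap (mkParams Q) x.length := by
    have : (urest D pat).length = kap (mkParams Q) x.length - D.κ := by simp [urest]
    rw [List.length_append, length_lowBits, this]; have := D.hκ; unfold GoodData.κ at *; omega
  obtain ⟨hq, hr⟩ := (mem_pointSet_iff_rank D.Δ_pos _ _ x').1 hx'
  change rank D.Δ (nOf x.length) (qLevels x.length D.pl) x' < 2 ^ Regev2004.kappa (nOf x.length) (qLevels x.length D.pl) (radius D.pl D.G0) at hr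
  rw [← numIdx_eq_kappa] at hr
  unfold xbar idxOf
  rw [partnerPat, ixS_mkPat hlen, List.take_left' (length_lowBits _ _), bitsToNat_lowBits (K := D.κ) hr, unrank_rank D.Δ_pos hq]

/-- The junk coins of the partner pattern. [folklore] -/
theorem urest_partnerPat (t' : Bool) (a' x' : Fin (nOf x.length) → ℤ) : urest D (partnerPat D pat t' a' x') = urest D pat := by
  have hlen : (lowBits D.κ (rank D.Δ (nOf x.length) (qLevels x.length D.pl) x') ++ urest D pat).length = kap (mkParams Q) x.length := by
    have : (urest D pat).length = kap (mkParams Q) x.length - D.κ := by simp [urest]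
    rw [List.length_append, length_lowBits, this]; have := D.hκ; unfold GoodData.κ at *; omega
  conv_lhs => rw [urest, partnerPat, ixS_mkPat hlen, List.drop_left' (length_lowBits _ _)]

/-- **`surj`**: every element of the register relation of `regOf pat` is attained in the fibre. [cite: Regev2004, Claim 3.14 (the partner content)] -/
theorem surj_regOf (cb : Bool) (v : ℕ) (hrel : RegRel (modN (nOf x.length)) D.d0 (regOf D pat) cb v) :
    ∃ pat' : ZPat (mkParams Q) x.length (nOf x.length), (yOf D pat' = yOf D pat ∧ urest D pat' = urest D pat) ∧
      ctrl (mkParams Q) x.length (nOf x.length) pat' = cb ∧ val (mkParams Q) x.length (nOf x.length) pat' = v := by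
  have hbox := aZ_mem_box Q pat
  have hself : ctrl (mkParams Q) x.length (nOf x.length) pat = tOf Q pat ∧ val (mkParams Q) x.length (nOf x.length) pat = encA (aZ Q pat) :=
    ⟨ctrl_eq_tOf Q pat, by rw [val_eq_boxEnc, encA_eq hbox]⟩
  unfold regOf regOf' at hrel
  split_ifs at hrel with hP
  · -- a good register
    rcases hrel with ⟨h, -⟩ | ⟨-, ⟨rfl, hv⟩ | ⟨rfl, hv⟩⟩
    · exact absurd h (by simp)
    · -- control bit `0`: the type-0 element of the pair
      cases ht : tOf Q pat
      · rw [ht] at hv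
        simp only [baseA, Bool.false_eq_true, if_false] at hv
        exact ⟨pat, ⟨rfl, rfl⟩, by rw [hself.1, ht], by rw [hself.2]; exact hv.symm⟩
      · rw [ht] at hv hP
        simp only [baseA, if_true] at hv
        simp only [HasPartner, if_true] at hP
        refine ⟨partnerPat D pat false (aZ Q pat - D.δ) (xbar D pat + D.uv), ⟨?_, urest_partnerPat D pat _ _ _⟩, ?_, ?_⟩
        · rw [yOf, yOf, xbar_partnerPat D pat _ _ hP.2, partnerPat, aZ_mkPat _ _ hP.1, tZ_eq, tOf_mkPat, tZ_eq, ht,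
            if_neg Bool.false_ne_true, if_pos rfl, twoPoint_sub_delta D]
          abel
        · rw [ctrl_eq_tOf, partnerPat, tOf_mkPat]
        · rw [val_eq_boxEnc, partnerPat, aZ_mkPat _ _ hP.1, ← encA_eq hP.1, hv]
    · -- control bit `1`: the type-1 element of the pair
      cases ht : tOf Q pat
      · rw [ht] at hv hP
        simp only [baseA, Bool.false_eq_true, if_false] at hv
        simp only [HasPartner, Bool.false_eq_true, if_false] at hP
        refine ⟨partnerPat D pat true (aZ Q pat + D.δ) (xbar D pat - D.uv), ⟨?_, urest_partnerPat D pat _ _ _⟩, ?_, ?_⟩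
        · rw [yOf, yOf, xbar_partnerPat D pat _ _ hP.2, partnerPat, aZ_mkPat _ _ hP.1, tZ_eq, tOf_mkPat, tZ_eq, ht,
            if_pos rfl, if_neg Bool.false_ne_true, twoPoint_add_delta D]
          abel
        · rw [ctrl_eq_tOf, partnerPat, tOf_mkPat]
        · rw [val_eq_boxEnc, partnerPat, aZ_mkPat _ _ hP.1, ← encA_eq hP.1, encA_add_delta D hbox hP.1, hv]
      · rw [ht] at hv hP
        simp only [baseA, if_true] at hv
        simp only [HasPartner, if_true] at hP
        refine ⟨pat, ⟨rfl, rfl⟩, by rw [hself.1, ht], ?_⟩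
        rw [hself.2, hv]
        have := encA_add_delta D hP.1 (by rw [sub_add_cancel]; exact hbox)
        rw [sub_add_cancel] at this
        exact this
  · -- a bad register: the pattern itself
    rcases hrel with ⟨h, hv⟩ | ⟨h, -⟩
    · simp only [Option.some.injEq] at h
      exact ⟨pat, ⟨rfl, rfl⟩, by rw [hself.1, h], by rw [hself.2]; exact hv.symm⟩
    · exact absurd h (by simp)

/-- **`dead`**: on a dead register the first block copies `(ix, ta)`, so its value determines the
pattern. [folklore] -/
theorem dead_of_wOut_eq (h : ([], ([], (ixS Q pat', taS Q pat'))) = (([], ([], (ixS Q pat, taS Q pat))) : WOut)) : pat' = pat := by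
  have hix : ixS Q pat' = ixS Q pat := congrArg (fun o : WOut => o.2.2.1) h
  have hta : taS Q pat' = taS Q pat := congrArg (fun o : WOut => o.2.2.2) h
  refine pat_ext (Q := Q) ?_ hix ?_
  · rw [← ctrlBit_taS, ← ctrlBit_taS, hta]
  · have := congrArg (digitsOf (nOf x.length)) hta
    rw [digitsOf_taS, digitsOf_taS] at this
    exact List.ofFn_injective this

/-- **The fibre hypotheses of file VII for a genuine input with the right guesses.** [cite: Regev2004, Claims 3.13–3.14 and proof of Lemma 3.12 (p. 14)] -/
def fibreHyp : FibreHyp (mkParams Q) (semHyp Q) x D.Good D.G0.r' D.d0 where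
  hr := D.hr
  fits := D.fits
  act_iff := fun _ hg k _ => act_iff_good D hg k
  act_congr := fun g g' k hg' => by
    change Live Q.sizes x.length (payloadOf x) (readGuess Q.sizes x.length (payloadOf x) (gBits Q x.length g')) k ↔
      Live Q.sizes x.length (payloadOf x) (readGuess Q.sizes x.length (payloadOf x) (gBits Q x.length (gExt (mkParams Q) x.length g))) k
    rw [show gBits Q x.length g' = gBits Q x.length (gExt (mkParams Q) x.length g) from by
      unfold gBits; congr 1; funext t; exact hg' t t.isLt]
  regOf := fun _ _ pat => regOf D pat
  rel := fun g hg k pat pat' hfw => by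
    obtain ⟨hy, hu⟩ := (fW_eq_iff_live D hg k.isLt pat pat').1 hfw
    exact rel_of_yOf_eq D pat pat' hy hu
  inj := fun g hg k pat pat' hfw hc _ => by
    obtain ⟨hy, hu⟩ := (fW_eq_iff_live D hg k.isLt pat pat').1 hfw
    exact inj_of_yOf_eq D pat pat' hy hu hc
  surj := fun g hg k pat cb v hrel => by
    obtain ⟨pat', hyu, hc, hv⟩ := surj_regOf D pat cb v hrel
    exact ⟨pat', (fW_eq_iff_live D hg k.isLt pat pat').2 hyu, hc, hv⟩
  dead := fun g hg k hrk hk pat pat' hfw _ => by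
    have hkr : k ≤ rmax (mkParams Q) x.length := hk.le
    rw [fW_zW pat g hkr, fW_zW pat' g hkr, wOutE_injective.eq_iff, wOut_dead D pat hg (not_lt.2 hrk), wOut_dead D pat' hg (not_lt.2 hrk)] at hfw
    exact dead_of_wOut_eq pat pat' hfw

end Fibre

/-! ### Counting the register contents with a partner (Claim 3.14, quantitative part) -/

section Count

variable (pat : ZPat (mkParams Q) x.length (nOf x.length))

/-- The register content `(t, ā, x̄)` of a zone pattern. [cite: Regev2004, Lemma 3.12 (proof, p. 14: the basis states |t, ā, x̄⟩)] -/
def contentOf : Bool × (Fin (nOf x.length) → ℤ) × (Fin (nOf x.length) → ℤ) := (tOf Q pat, aZ Q pat, xbar D pat)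

/-- The content of a pattern lies in `{0,1} × A × X`. [folklore] -/
theorem contentOf_mem : contentOf D pat ∈ contents (box (nOf x.length) (2 ^ (4 * nOf x.length))) D.X :=
  (mem_contents_iff _ _ _).2 ⟨aZ_mem_box Q pat, xbar_mem D pat⟩

/-- **A register is good iff the partner of its content is again a content.** [cite: Regev2004, Claim 3.14] -/
theorem regOf_fst_eq_none_iff : (regOf D pat).1 = none ↔
    partner D.δ D.uv (contentOf D pat) ∈ contents (box (nOf x.length) (2 ^ (4 * nOf x.length))) D.X := by
  have key : (regOf D pat).1 = none ↔ HasPartner D (tOf Q pat) (aZ Q pat) (xbar D pat) := by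
    unfold regOf regOf'; split_ifs with h <;> simp [h]
  rw [key, HasPartner, contentOf, mem_contents_iff]
  cases tOf Q pat <;> simp [partner]

/-- The junk coins have length `kap − κ`. [folklore] -/
theorem length_urest : (urest D pat).length = kap (mkParams Q) x.length - D.κ := by simp [urest]

/-- An `ix` string assembled from `κ` low bits and junk coins has length `kap`. [folklore] -/
theorem length_lowBits_append {u : List Bool} (hu : u.length = kap (mkParams Q) x.length - D.κ) (r : ℕ) :
    (lowBits D.κ r ++ u).length = kap (mkParams Q) x.length := by
  rw [List.length_append, length_lowBits, hu]; have := D.hκ; unfold GoodData.κ at *; omega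

/-- **The pattern with junk coins `u` and content `(t, ā, x̄')`.** [folklore] -/
def mkPatC (u : List Bool) (t : Bool) (a x' : Fin (nOf x.length) → ℤ) : ZPat (mkParams Q) x.length (nOf x.length) :=
  mkPat (Q := Q) (lowBits D.κ (rank D.Δ (nOf x.length) (qLevels x.length D.pl) x') ++ u) t a

/-- Its control bit. [folklore] -/
@[simp] theorem tOf_mkPatC (u : List Bool) (t : Bool) (a x' : Fin (nOf x.length) → ℤ) : tOf Q (mkPatC D u t a x') = t :=
  tOf_mkPat _ _ _

/-- Its digits. [folklore] -/
theorem aZ_mkPatC (u : List Bool) (t : Bool) {a : Fin (nOf x.length) → ℤ} (ha : a ∈ box (nOf x.length) (2 ^ (4 * nOf x.length)))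
    (x' : Fin (nOf x.length) → ℤ) : aZ Q (mkPatC D u t a x') = a :=
  aZ_mkPat _ _ ha

/-- Its grid point. [folklore] -/
theorem xbar_mkPatC {u : List Bool} (hu : u.length = kap (mkParams Q) x.length - D.κ) (t : Bool) (a : Fin (nOf x.length) → ℤ)
    {x' : Fin (nOf x.length) → ℤ} (hx' : x' ∈ D.X) : xbar D (mkPatC D u t a x') = x' := by
  obtain ⟨hq, hr⟩ := (mem_pointSet_iff_rank D.Δ_pos _ _ x').1 hx'
  change rank D.Δ (nOf x.length) (qLevels x.length D.pl) x' < 2 ^ Regev2004.kappa (nOf x.length) (qLevels x.length D.pl) (radius D.pl D.G0) at hr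
  rw [← numIdx_eq_kappa] at hr
  unfold xbar idxOf
  rw [mkPatC, ixS_mkPat (length_lowBits_append D hu _), List.take_left' (length_lowBits _ _), bitsToNat_lowBits (K := D.κ) hr,
    unrank_rank D.Δ_pos hq]

/-- Its junk coins. [folklore] -/
theorem urest_mkPatC {u : List Bool} (hu : u.length = kap (mkParams Q) x.length - D.κ) (t : Bool) (a x' : Fin (nOf x.length) → ℤ) :
    urest D (mkPatC D u t a x') = u := by
  conv_lhs => rw [urest, mkPatC, ixS_mkPat (length_lowBits_append D hu _), List.drop_left' (length_lowBits _ _)]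

/-- Its content. [folklore] -/
theorem contentOf_mkPatC {u : List Bool} (hu : u.length = kap (mkParams Q) x.length - D.κ)
    {c : Bool × (Fin (nOf x.length) → ℤ) × (Fin (nOf x.length) → ℤ)} (hc : c ∈ contents (box (nOf x.length) (2 ^ (4 * nOf x.length))) D.X) :
    contentOf D (mkPatC D u c.1 c.2.1 c.2.2) = c := by
  obtain ⟨ha, hx'⟩ := (mem_contents_iff _ _ _).1 hc
  simp only [contentOf, tOf_mkPatC, aZ_mkPatC D _ _ ha, xbar_mkPatC D hu _ _ hx']

/-- **A pattern is recovered from its junk coins and its content.** [folklore] -/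
theorem mkPatC_urest_contentOf : mkPatC D (urest D pat) (tOf Q pat) (aZ Q pat) (xbar D pat) = pat := by
  refine pat_ext (Q := Q) (tOf_mkPatC D _ _ _ _) ?_ ?_
  · rw [mkPatC, ixS_mkPat (length_lowBits_append D (length_urest D pat) _), rank_xbar]
    exact (ixS_eq_append D pat).symm
  · funext i
    have := congrFun (aZ_mkPatC D (urest D pat) (tOf Q pat) (aZ_mem_box Q pat) (xbar D pat)) i
    simp only [aZ, Nat.cast_inj] at this
    exact this

/-- **Every content has exactly `2^{kap − κ}` patterns** (one for each value of the junk coins). [folklore] -/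
theorem card_filter_contentOf_eq {c : Bool × (Fin (nOf x.length) → ℤ) × (Fin (nOf x.length) → ℤ)}
    (hc : c ∈ contents (box (nOf x.length) (2 ^ (4 * nOf x.length))) D.X) :
    (univ.filter fun p : ZPat (mkParams Q) x.length (nOf x.length) => contentOf D p = c).card = 2 ^ (kap (mkParams Q) x.length - D.κ) := by
  have hlen : ∀ u : Fin (kap (mkParams Q) x.length - D.κ) → Bool, (List.ofFn u).length = kap (mkParams Q) x.length - D.κ := fun u => by simp
  symm
  rw [← Fintype.card_fin (kap (mkParams Q) x.length - D.κ), ← Fintype.card_bool, ← Fintype.card_fun, ← Finset.card_univ]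
  refine Finset.card_bij (fun u _ => mkPatC D (List.ofFn u) c.1 c.2.1 c.2.2) (fun u _ => ?_) (fun u₁ _ u₂ _ h => ?_) (fun p hp => ?_)
  · exact mem_filter.2 ⟨mem_univ _, contentOf_mkPatC D (hlen u) hc⟩
  · have h' := congrArg (urest D) h
    rw [urest_mkPatC D (hlen u₁), urest_mkPatC D (hlen u₂)] at h'
    exact List.ofFn_injective h'
  · obtain ⟨-, hpc⟩ := mem_filter.1 hp
    refine ⟨fun j => (urest D p).getD j false, mem_univ _, ?_⟩
    have e : List.ofFn (fun j : Fin (kap (mkParams Q) x.length - D.κ) => (urest D p).getD j false) = urest D p := by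
      apply List.ext_getElem (by simp [length_urest])
      intro j h1 h2
      rw [List.getElem_ofFn, List.getD_eq_getElem _ _ h2]
    rw [e, ← hpc]
    exact mkPatC_urest_contentOf D p

/-- **The number of good registers**: `2^{kap − κ}` times the number of contents whose partner is a
content. [cite: Regev2004, Claim 3.14] -/
theorem card_filter_regOf_none :
    (univ.filter fun p : ZPat (mkParams Q) x.length (nOf x.length) => (regOf D p).1 = none).card =
      2 ^ (kap (mkParams Q) x.length - D.κ) *
        ((contents (box (nOf x.length) (2 ^ (4 * nOf x.length))) D.X).filter fun c =>
          partner D.δ D.uv c ∈ contents (box (nOf x.length) (2 ^ (4 * nOf x.length))) D.X).card := by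
  have e : (univ.filter fun p : ZPat (mkParams Q) x.length (nOf x.length) => (regOf D p).1 = none) =
      univ.filter fun p => partner D.δ D.uv (contentOf D p) ∈ contents (box (nOf x.length) (2 ^ (4 * nOf x.length))) D.X :=
    filter_congr fun p _ => regOf_fst_eq_none_iff D p
  rw [e, card_eq_sum_card_fiberwise (f := contentOf D)
    (t := (contents (box (nOf x.length) (2 ^ (4 * nOf x.length))) D.X).filter fun c =>
      partner D.δ D.uv c ∈ contents (box (nOf x.length) (2 ^ (4 * nOf x.length))) D.X)
    (fun p hp => mem_filter.2 ⟨contentOf_mem D p, (mem_filter.1 hp).2⟩)]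
  have hfib : ∀ c ∈ (contents (box (nOf x.length) (2 ^ (4 * nOf x.length))) D.X).filter fun c =>
      partner D.δ D.uv c ∈ contents (box (nOf x.length) (2 ^ (4 * nOf x.length))) D.X,
      ((univ.filter fun p : ZPat (mkParams Q) x.length (nOf x.length) =>
        partner D.δ D.uv (contentOf D p) ∈ contents (box (nOf x.length) (2 ^ (4 * nOf x.length))) D.X).filter
          fun p => contentOf D p = c).card = 2 ^ (kap (mkParams Q) x.length - D.κ) := by
    intro c hc
    obtain ⟨hc, hgood⟩ := mem_filter.1 hc
    rw [filter_filter, ← card_filter_contentOf_eq D hc]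
    congr 1
    exact filter_congr fun p _ => ⟨fun h => h.2, fun h => ⟨by rw [h]; exact hgood, h⟩⟩
  rw [sum_congr rfl hfib, sum_const, smul_eq_mul, mul_comm]

/-- **The number of zone patterns** is `2^{kap − κ} · 2|A||X|`. [folklore] -/
theorem card_ZPat_eq : Fintype.card (ZPat (mkParams Q) x.length (nOf x.length)) =
    2 ^ (kap (mkParams Q) x.length - D.κ) * (2 * (box (nOf x.length) (2 ^ (4 * nOf x.length))).card * D.X.card) := by
  rw [card_ZPat, card_box, GoodData.X, card_pointSet,
    show Regev2004.kappa (nOf x.length) (qLevels x.length D.pl) D.Δ = D.κ from (numIdx_eq_kappa _ _ _).symm, ← pow_mul]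
  have hk : kap (mkParams Q) x.length = D.κ + (kap (mkParams Q) x.length - D.κ) := by
    have := D.hκ; unfold GoodData.κ at *; omega
  generalize kap (mkParams Q) x.length - D.κ = d at hk
  rw [hk]
  ring

/-- **The fraction of good registers** from a bound of the bad contents: if the four boundary counts of
Claim 3.14 add up to at most `η · 2|A||X|`, then at least a fraction `1 − η` of the zone patterns give a
good register. [cite: Regev2004, Claim 3.14] -/
theorem hfrac_of_bad_le {η : ℝ}
    (hbad : ((((box (nOf x.length) (2 ^ (4 * nOf x.length))).filter fun a => a + D.δ ∉ box (nOf x.length) (2 ^ (4 * nOf x.length))).card +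
        ((box (nOf x.length) (2 ^ (4 * nOf x.length))).filter fun a => a - D.δ ∉ box (nOf x.length) (2 ^ (4 * nOf x.length))).card) *
          D.X.card +
        (box (nOf x.length) (2 ^ (4 * nOf x.length))).card *
          ((D.X.filter fun y => y - D.uv ∉ D.X).card + (D.X.filter fun y => y + D.uv ∉ D.X).card) : ℝ) ≤
        η * (2 * (box (nOf x.length) (2 ^ (4 * nOf x.length))).card * D.X.card)) :
    (1 - η) * Fintype.card (ZPat (mkParams Q) x.length (nOf x.length)) ≤
      ((univ.filter fun p : ZPat (mkParams Q) x.length (nOf x.length) => (regOf D p).1 = none).card : ℝ) := by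
  have hge := (Nat.cast_le (α := ℝ)).2 (card_filter_partner_mem_ge (box (nOf x.length) (2 ^ (4 * nOf x.length))) D.X D.δ D.uv)
  push_cast at hge
  rw [card_filter_regOf_none, card_ZPat_eq D]
  push_cast
  have h1 : (1 - η) * (2 * ((box (nOf x.length) (2 ^ (4 * nOf x.length))).card : ℝ) * D.X.card) ≤
      ((contents (box (nOf x.length) (2 ^ (4 * nOf x.length))) D.X).filter fun c =>
        partner D.δ D.uv c ∈ contents (box (nOf x.length) (2 ^ (4 * nOf x.length))) D.X).card := by
    linarith
  calc (1 - η) * ((2 : ℝ) ^ (kap (mkParams Q) x.length - D.κ) * (2 * ((box (nOf x.length) (2 ^ (4 * nOf x.length))).card : ℝ) * D.X.card))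
        = (2 : ℝ) ^ (kap (mkParams Q) x.length - D.κ) * ((1 - η) * (2 * ((box (nOf x.length) (2 ^ (4 * nOf x.length))).card : ℝ) * D.X.card)) := by
        ring
    _ ≤ _ := mul_le_mul_of_nonneg_left h1 (by positivity)

/-- The relative shift error is nonnegative. [folklore] -/
theorem shiftEps_nonneg {m Q' Δ : ℕ} (hr : 0 < innerRad m Q' Δ) {σ : ℝ} (hσ : 0 ≤ σ) : 0 ≤ shiftEps m Q' Δ σ := by
  have hR := outerRad_pos m Q' Δ
  have hq1 : 1 ≤ outerRad m Q' Δ / innerRad m Q' Δ := by rw [le_div_iff₀ hr, one_mul]; exact innerRad_le_outerRad m Q' Δ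
  have hp : 1 ≤ (outerRad m Q' Δ / innerRad m Q' Δ) ^ (m + 1) := one_le_pow₀ hq1
  have hc : 0 ≤ secConst m := by unfold secConst; positivity
  unfold shiftEps
  have t2 : 0 ≤ secConst m / innerRad m Q' Δ * σ := by positivity
  have t3 : 0 ≤ secConst m / outerRad m Q' Δ * (σ + 2 * Real.sqrt (m + 1 : ℝ)) * (outerRad m Q' Δ / innerRad m Q' Δ) ^ (m + 1) := by
    positivity
  linarith

/-- **Claim 3.14 for the point set in dimension `n ≥ 2`, real form**: `#{y ∈ X | y − s ∉ X} ≤ 2ε(‖s‖)|X|`.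
[cite: Regev2004, Claim 3.14 (p. 15) with Cor. 3.9 and Claim 3.7] -/
theorem card_filter_sub_notMem_pointSet_le {n Q' Δ : ℕ} (hΔ : 0 < Δ) (hn : 2 ≤ n) (hQ : n ≤ Q') (hr : 0 < innerRad (n - 1) Q' Δ)
    (s : Fin n → ℤ) :
    (((pointSet n Q' Δ hΔ).filter fun y => y - s ∉ pointSet n Q' Δ hΔ).card : ℝ) ≤
      2 * shiftEps (n - 1) Q' Δ ‖intVecToEuclidean n s‖ * (pointSet n Q' Δ hΔ).card := by
  obtain ⟨m, rfl⟩ : ∃ m, n = m + 1 := ⟨n - 1, by omega⟩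
  rw [Nat.add_sub_cancel] at hr ⊢
  have hm : 0 < m := by omega
  have h := card_filter_sub_notMem_le_mul_card_pointSet hΔ hm hQ hr s
  have hε : 0 ≤ 2 * shiftEps m Q' Δ ‖intVecToEuclidean (m + 1) s‖ := mul_nonneg (by norm_num) (shiftEps_nonneg hr (norm_nonneg _))
  rw [← ENNReal.ofReal_natCast, ← ENNReal.ofReal_natCast, ← ENNReal.ofReal_mul hε,
    ENNReal.ofReal_le_ofReal_iff (mul_nonneg hε (Nat.cast_nonneg _))] at h
  exact h

/-- The arithmetic of Claim 3.14: the four boundary counts against `η · 2|A||X|`. [folklore] -/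
theorem bad_le_of_numeric {a₁ a₂ b₁ b₂ A X M P S ε η : ℝ} (hX : 0 ≤ X) (hM : 0 < M) (hP : 0 ≤ P) (hA : A = M * P)
    (h1 : a₁ ≤ S * P) (h2 : a₂ ≤ S * P) (h3 : b₁ ≤ 2 * ε * X) (h4 : b₂ ≤ 2 * ε * X) (hnum : S / M + 2 * ε ≤ η) :
    (a₁ + a₂) * X + A * (b₁ + b₂) ≤ η * (2 * A * X) := by
  subst hA
  have key := mul_le_mul_of_nonneg_left hnum (show (0 : ℝ) ≤ 2 * M * P * X by positivity)
  have e : 2 * M * P * X * (S / M + 2 * ε) = 2 * P * X * S + 4 * M * P * X * ε := by field_simp; ring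
  rw [e] at key
  have h12 := mul_le_mul_of_nonneg_right (add_le_add h1 h2) hX
  have h34 := mul_le_mul_of_nonneg_left (add_le_add h3 h4) (show (0 : ℝ) ≤ M * P by positivity)
  linarith

/-- **The fraction of good registers from the numerical condition** `(∑ᵢ |δᵢ|)/M + 2ε(‖ū‖) ≤ η`
(`M = 2^{4n}`, `ε` the relative shift error of the point set). [cite: Regev2004, Claim 3.14 (p. 15: the two error terms n2^{2n+1}/M and the ball estimate)] -/
theorem hfrac_of_numeric {η : ℝ} (hn : 2 ≤ nOf x.length) (hQ : nOf x.length ≤ qLevels x.length D.pl)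
    (hr : 0 < innerRad (nOf x.length - 1) (qLevels x.length D.pl) D.Δ)
    (hnum : (∑ i, ((D.δ i).natAbs : ℝ)) / 2 ^ (4 * nOf x.length) +
        2 * shiftEps (nOf x.length - 1) (qLevels x.length D.pl) D.Δ ‖intVecToEuclidean (nOf x.length) D.uv‖ ≤ η) :
    (1 - η) * Fintype.card (ZPat (mkParams Q) x.length (nOf x.length)) ≤
      ((univ.filter fun p : ZPat (mkParams Q) x.length (nOf x.length) => (regOf D p).1 = none).card : ℝ) := by
  apply hfrac_of_bad_le
  have h1 := (Nat.cast_le (α := ℝ)).2 (card_filter_add_notMem_box_le (n := nOf x.length) (2 ^ (4 * nOf x.length)) D.δ)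
  have h2 := (Nat.cast_le (α := ℝ)).2 (card_filter_sub_notMem_box_le (n := nOf x.length) (2 ^ (4 * nOf x.length)) D.δ)
  have h3 := card_filter_sub_notMem_pointSet_le D.Δ_pos hn hQ hr D.uv
  have h4 := card_filter_sub_notMem_pointSet_le D.Δ_pos hn hQ hr (-D.uv)
  simp only [sub_neg_eq_add, map_neg, norm_neg] at h4
  change ((D.X.filter fun y => y - D.uv ∉ D.X).card : ℝ) ≤ _ * D.X.card at h3
  change ((D.X.filter fun y => y + D.uv ∉ D.X).card : ℝ) ≤ _ * D.X.card at h4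
  push_cast at h1 h2
  rw [card_box]
  push_cast
  have hA : ((2 : ℝ) ^ (4 * nOf x.length)) ^ nOf x.length = (2 : ℝ) ^ (4 * nOf x.length) * ((2 : ℝ) ^ (4 * nOf x.length)) ^ (nOf x.length - 1) := by
    rw [← pow_succ']; congr 1; omega
  exact bad_le_of_numeric (Nat.cast_nonneg _) (by positivity) (by positivity) hA h1 h2 h3 h4 hnum

end Count

/-! ### Counting the good guess patterns -/

section GoodCount

namespace GoodData

/-- The total width of the four guess fields. [folklore] -/
def wTot : ℕ :=
  (widths Q.sizes x.length D.pl).1 + ((widths Q.sizes x.length D.pl).2.1 + ((widths Q.sizes x.length D.pl).2.2.1 + (widths Q.sizes x.length D.pl).2.2.2))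

/-- The bits of the right guesses, field by field. [cite: Regev2004, Thm. 1.1 (proof, p. 7: the values l, m, i₀)] -/
def fieldBits : List Bool :=
  lowBits (widths Q.sizes x.length D.pl).1 D.G0.rho ++ (lowBits (widths Q.sizes x.length D.pl).2.1 D.G0.m ++
    (lowBits (widths Q.sizes x.length D.pl).2.2.1 D.G0.i0 ++ lowBits (widths Q.sizes x.length D.pl).2.2.2 D.G0.r'))

/-- `fieldBits` has length `wTot`. [folklore] -/
@[simp] theorem length_fieldBits : D.fieldBits.length = D.wTot := by
  simp [fieldBits, wTot]

/-- **Reading the guesses off `fieldBits ++ rest` gives the right guesses.** [folklore] -/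
theorem readGuess_fieldBits_append (rest : List Bool) : readGuess Q.sizes x.length D.pl (D.fieldBits ++ rest) = D.G0 := by
  have w1 : D.G0.rho < 2 ^ (widths Q.sizes x.length D.pl).1 := D.hrho.trans (Nat.lt_size_self _)
  have w2 : D.G0.m < 2 ^ (widths Q.sizes x.length D.pl).2.1 := D.hmp.trans (Nat.lt_size_self _)
  have w3 : D.G0.i0 < 2 ^ (widths Q.sizes x.length D.pl).2.2.1 := D.hi0.trans (Nat.lt_size_self _)
  have w4 : D.G0.r' < 2 ^ (widths Q.sizes x.length D.pl).2.2.2 := lt_of_le_of_lt D.hr (Nat.lt_size_self _)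
  have l1 := length_lowBits (widths Q.sizes x.length D.pl).1 D.G0.rho
  have l2 := length_lowBits (widths Q.sizes x.length D.pl).2.1 D.G0.m
  have l3 := length_lowBits (widths Q.sizes x.length D.pl).2.2.1 D.G0.i0
  have l4 := length_lowBits (widths Q.sizes x.length D.pl).2.2.2 D.G0.r'
  unfold readGuess fieldBits
  simp only [List.append_assoc]
  rw [List.take_left' l1, List.drop_left' l1, List.take_left' l2, ← List.drop_drop, List.drop_left' l1, List.drop_left' l2,
    List.take_left' l3, ← List.drop_drop, ← List.drop_drop, List.drop_left' l1, List.drop_left' l2, List.drop_left' l3,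
    List.take_left' l4, bitsToNat_lowBits w1, bitsToNat_lowBits w2, bitsToNat_lowBits w3, bitsToNat_lowBits w4]

/-- The guess pattern with the right fields and free bits `u`. [folklore] -/
def gpOf (hW : D.wTot ≤ gam (mkParams Q) x.length) (u : Fin (gam (mkParams Q) x.length - D.wTot) → Bool) : GPat (mkParams Q) x.length :=
  fun t => if h : (t : ℕ) < D.wTot then D.fieldBits.getD t false else u ⟨t - D.wTot, by have := t.isLt; omega⟩

/-- As a list, `gpOf u` is `fieldBits ++ u`. [folklore] -/
theorem ofFn_gpOf (hW : D.wTot ≤ gam (mkParams Q) x.length) (u : Fin (gam (mkParams Q) x.length - D.wTot) → Bool) :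
    List.ofFn (D.gpOf hW u) = D.fieldBits ++ List.ofFn u := by
  apply List.ext_getElem (by simp; omega)
  intro j h1 h2
  rw [List.getElem_ofFn]
  unfold gpOf
  by_cases hj : j < D.wTot
  · rw [dif_pos hj, List.getElem_append_left (by simpa using hj), List.getD_eq_getElem _ _ (by simpa using hj)]
  · rw [dif_neg hj, List.getElem_append_right (by simp; omega)]
    simp

/-- **`gpOf u` is good.** [folklore] -/
theorem good_gpOf (hW : D.wTot ≤ gam (mkParams Q) x.length) (u : Fin (gam (mkParams Q) x.length - D.wTot) → Bool) : D.Good (D.gpOf hW u) := by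
  unfold Good; rw [ofFn_gpOf]; exact D.readGuess_fieldBits_append _

/-- `gpOf` is injective. [folklore] -/
theorem gpOf_injective (hW : D.wTot ≤ gam (mkParams Q) x.length) : Function.Injective (D.gpOf hW) := by
  intro u u' h
  funext j
  have := congrFun h ⟨D.wTot + j, by have := j.isLt; omega⟩
  unfold gpOf at this
  rw [dif_neg (by simp), dif_neg (by simp)] at this
  simpa using this

/-- **At least `2^{gam − wTot}` guess patterns are good.** [cite: Regev2004, Thm. 1.1 (proof, p. 7: "with probability 1/poly(n) all guesses are correct")] -/
theorem two_pow_le_card_good (hW : D.wTot ≤ gam (mkParams Q) x.length) :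
    2 ^ (gam (mkParams Q) x.length - D.wTot) ≤ (univ.filter D.Good).card := by
  calc 2 ^ (gam (mkParams Q) x.length - D.wTot) = (univ.image (D.gpOf hW)).card := by
        rw [card_image_of_injective _ (D.gpOf_injective hW), card_univ, Fintype.card_fun, Fintype.card_bool, Fintype.card_fin]
    _ ≤ (univ.filter D.Good).card := by
        apply card_le_card
        intro g hg
        obtain ⟨u, -, rfl⟩ := mem_image.1 hg
        exact mem_filter.2 ⟨mem_univ _, D.good_gpOf hW u⟩

end GoodData

end GoodCount

end Good


end RegevRoutine

end Literature.Algebra.EuclideanLattices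

end
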